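import Literature.ComputerArithmetic.OzakiOgitaOishiRump2012.ErrorFreeTransformation

/-!
# Ozaki–Ogita–Oishi–Rump 2012, Theorem 1 — the TWO-SWEEP ROW SPLITTING instance used by `cap.ila`
# (binary64, `α = 32`, second sweep `20` binades lower, panel inner dimension `≤ 2048`)

HONEST FRAMING (cell certnum, seat certnum-ila-2; serves the «split» residual lineage of
`cap.ila.eigsparse` 0.4.0 and the split residual mode of `cap.ila.mfldl`): shared numerical engines
serving client cells; rigour lives in the verifiers; every published number belongs to a client cell's
ledger. This file PROVES the representability / exactness statement that the hypothesis H-BLAS-EXACT of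
those kernels is conditioned on, as an INSTANCE of [cite: OzakiOgitaOishiRump2012, Theorem 1] (tree:
`ErrorFreeTransformation.lean`, `dot_eval_eq_exact`, `splitEntry_spec`).

THE KERNEL'S SPLITTING (`cap.ila.mfldl._split3`, `cap.ila.eftsplit.split3`). For a row `g` of a dense
panel with row maximum `μ < 2^E` (`E` from `frexp`), with `σ₁ = 2^{E+32}` and `σ₂ = 2^{E+12}`:
`g¹ = fl(fl(σ₁ + g) − σ₁)`, `r = fl(g − g¹)`, `g² = fl(fl(σ₂ + r) − σ₂)`, `g³ = fl(r − g²)` — two sweeps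
of the paper's splitting step (13)/(15) (= `ExtractScalar` with `M = α = 32`, so parts keep
`p − α = 21` bits) at the row exponents `E` and `E − 20`. This is `twoSweep fl 32 20 E` below.

TYPED AND PROVED HERE (format level: precision `p`, gradual underflow `2^{emin}`, any round-to-nearest
`fl`, then specialised to binary64 `p = 53`, `emin = −1074`):
* `twoSweep_spec` — `g = g¹ + g² + g³` exactly; `g¹ ∈ 2^{α+E−p}ℤ`, `|g¹| ≤ 2^E`; `g² ∈ 2^{α+E−δ−p}ℤ`,
  `|g²| ≤ 2^{E−δ}`; `|g³| ≤ 2^{α+E−δ−p}`; all three are floating-point numbers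
  (binary64, `α = 32`, `δ = 20`: grids `2^{E−21}ℤ`, `2^{E−41}ℤ`, bounds `2^E`, `2^{E−20}`, `2^{E−41}`).
* `slice_dot_eval_eq_exact` — for two panels split row-wise this way (row exponents `E i`, `F j`), EVERY
  floating-point evaluation of a slice dot product `Σ_k Pʳ_{ik} Qˢ_{jk}` (`r, s ∈ {1, 2}`; any order, any
  blocking, with or without fused multiply-add — the `DotTree` of `JeannerodRump2013`) is EXACT, provided
  `n·2^{2(p−α)} ≤ 2^p` and the product grid is not below `2^{emin}`.
* `binary64_slice_dot_eval_eq_exact` — the numbers of record: `p = 53`, `emin = −1074`, `α = 32`,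
  `δ = 20`, row exponents in `[−450, 450]` (the kernels' exponent window), inner dimension `n ≤ 2048`:
  no side condition is left.
WHAT THIS DOES NOT SAY: that a given BLAS library evaluates `dgemm` entries as such a `DotTree` of the
`n` products of the stored operands (no Strassen-type recombination, no reduced / mixed precision path,
round-to-nearest binary64 operations only) — that is the kernels' RUNTIME hypothesis H-BLAS-EXACT, recorded
and self-tested in every certificate that uses it; nor anything about the remainder products involving
`g³` (bounded a priori by the kernels, standard model).
OVERFLOW (certnum-ref-2, signature of 2026-08-27T17:07:29Z): the tree's floating-point model `IsFloat p emin`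
has NO upper exponent bound, so «exact» / «no side condition is left» below are statements about binary64
WITHOUT OVERFLOW; real binary64 needs every intermediate of every evaluation to stay finite. The kernels'
CHECKED window gives it: row exponents `≤ 450` ⇒ slice grids `c, d ≤ 429`, `c + d ≤ 858`, and then EVERY
intermediate of EVERY evaluation has modulus `≤ 2^53·2^{c+d} ≤ 2^911 < 2^1024` — proved below as
`binary64_partial_eval_exact_and_abs_le` / `binary64_partial_eval_abs_le_two_pow_911` (every sub-evaluation
of the products is itself exact and bounded), the formal content of «no overflow can occur in the window».
-/

namespace Literature.ComputerArithmetic.OzakiOgitaOishiRump2012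

open Literature.ComputerArithmetic.JeannerodRump2018
open Literature.ComputerArithmetic.RumpOgitaOishi2008
open Literature.ComputerArithmetic.JeannerodRump2013 (DotTree)
open Finset

variable {p : ℕ} {emin : ℤ} {fl : ℚ → ℚ}

/-- TWO SWEEPS of the splitting step (13)/(15) on one entry `x` of a row with `|x| ≤ 2^E`: scales
`σ₁ = 2^α 2^E`, `σ₂ = 2^α 2^{E−δ}`; returns `(g¹, g², g³)` = (first part, second part, remainder).
[cite: OzakiOgitaOishiRump2012, §2.4 eqs. (13)–(15)] -/
def twoSweep (fl : ℚ → ℚ) (α δ : ℕ) (E : ℤ) (x : ℚ) : ℚ × ℚ × ℚ :=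
  ((splitEntry fl α E x).1,
    (splitEntry fl α (E - δ) (splitEntry fl α E x).2).1,
    (splitEntry fl α (E - δ) (splitEntry fl α E x).2).2)

/-- The operations of `twoSweep`, literally as the kernels perform them:
`g¹ = fl(fl(σ₁ + x) − σ₁)`, `r = fl(x − g¹)`, `g² = fl(fl(σ₂ + r) − σ₂)`, `g³ = fl(r − g²)`.
[cite: OzakiOgitaOishiRump2012, §2.4 eq. (13)] -/
theorem twoSweep_eq (fl : ℚ → ℚ) (α δ : ℕ) (E : ℤ) (x : ℚ) :
    twoSweep fl α δ E x =
      (let σ₁ := (2 : ℚ) ^ ((α : ℤ) + E)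
       let σ₂ := (2 : ℚ) ^ ((α : ℤ) + (E - δ))
       let g₁ := fl (fl (σ₁ + x) - σ₁)
       let r := fl (x - g₁)
       let g₂ := fl (fl (σ₂ + r) - σ₂)
       (g₁, g₂, fl (r - g₂))) := rfl

/-- SPECIFICATION OF THE TWO SWEEPS (properties (2)–(5) of Algorithm 1 twice, eqs. (13)–(15)): for
`x ∈ F`, `|x| ≤ 2^E`, `α < p`, `δ ≤ p − α` (so that the first remainder, `≤ 2^{α+E−p}`, is within the
second sweep's range `2^{E−δ}`) and `2^{emin} ≤ σ₂`: `g¹ ∈ 2^{α+E−p}ℤ` with `|g¹| ≤ 2^E`,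
`g² ∈ 2^{α+E−δ−p}ℤ` with `|g²| ≤ 2^{E−δ}`, `|g³| ≤ 2^{α+E−δ−p}`, `x = g¹ + g² + g³` EXACTLY, and
`g¹, g², g³ ∈ F`. [cite: OzakiOgitaOishiRump2012, §2.2 eqs. (2)–(5) and §2.4 eqs. (13)–(16)] -/
theorem twoSweep_spec (hp : 1 ≤ p) (hfl : IsRoundNearest p emin fl) {α δ : ℕ} (hα : α < p)
    (hδ : (δ : ℤ) ≤ (p : ℤ) - α) {E : ℤ} (hE : emin ≤ (α : ℤ) + (E - δ)) {x : ℚ}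
    (hx : IsFloat p emin x) (hxE : |x| ≤ (2 : ℚ) ^ E) :
    OnGrid ((2 : ℚ) ^ ((α : ℤ) + E - p)) (twoSweep fl α δ E x).1 ∧
      |(twoSweep fl α δ E x).1| ≤ (2 : ℚ) ^ E ∧
      OnGrid ((2 : ℚ) ^ ((α : ℤ) + (E - δ) - p)) (twoSweep fl α δ E x).2.1 ∧
      |(twoSweep fl α δ E x).2.1| ≤ (2 : ℚ) ^ (E - δ) ∧
      |(twoSweep fl α δ E x).2.2| ≤ (2 : ℚ) ^ ((α : ℤ) + (E - δ) - p) ∧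
      x = (twoSweep fl α δ E x).1 + (twoSweep fl α δ E x).2.1 + (twoSweep fl α δ E x).2.2 ∧
      IsFloat p emin (twoSweep fl α δ E x).1 ∧ IsFloat p emin (twoSweep fl α δ E x).2.1 ∧
      IsFloat p emin (twoSweep fl α δ E x).2.2 := by
  have hE1 : emin ≤ (α : ℤ) + E := hE.trans (by omega)
  obtain ⟨hg1, hb1, hr1, hsum1, habs1⟩ := splitEntry_spec hp hfl hα hE1 hx hxE
  have hF1 := isFloat_splitEntry hfl α E x
  set s1 := splitEntry fl α E x with hs1
  have hrE : |s1.2| ≤ (2 : ℚ) ^ (E - δ) :=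
    habs1.trans (zpow_le_zpow_right₀ (by norm_num) (by omega))
  obtain ⟨hg2, hb2, hr2, hsum2, habs2⟩ := splitEntry_spec hp hfl hα hE hF1.2 hrE
  have hF2 := isFloat_splitEntry hfl α (E - δ) s1.2
  refine ⟨hg1, hb1, hg2, hb2, habs2, ?_, hF1.1, hF2.1, hF2.2⟩
  show x = s1.1 + (splitEntry fl α (E - δ) s1.2).1 + (splitEntry fl α (E - δ) s1.2).2
  rw [add_assoc, ← hsum2]; exact hsum1

/-- The two PARTS as a family: `part 0 = g¹`, `part 1 = g²`. [cite: OzakiOgitaOishiRump2012, §2.4 eq. (14)] -/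
def part (fl : ℚ → ℚ) (α δ : ℕ) (E : ℤ) (x : ℚ) (r : Fin 2) : ℚ :=
  if r = 0 then (twoSweep fl α δ E x).1 else (twoSweep fl α δ E x).2.1

/-- The grid exponent of part `r` of a row with exponent `E`: `α + E − δ·r − p` (`uσ^(r)` in the paper's
notation). [cite: OzakiOgitaOishiRump2012, §2.4 eqs. (14)–(15)] -/
def gridExp (p α δ : ℕ) (E : ℤ) (r : Fin 2) : ℤ := (α : ℤ) + (E - δ * (r : ℕ)) - p

/-- Each part lies on its grid and has at most `p − α` significant bits: `part r ∈ 2^{c}ℤ` and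
`|part r| ≤ 2^{p−α}·2^{c}` with `c = gridExp r`. [cite: OzakiOgitaOishiRump2012, §2.4 eqs. (14)–(15) with §2.2 (4)–(5)] -/
theorem part_spec (hp : 1 ≤ p) (hfl : IsRoundNearest p emin fl) {α δ : ℕ} (hα : α < p)
    (hδ : (δ : ℤ) ≤ (p : ℤ) - α) {E : ℤ} (hE : emin ≤ (α : ℤ) + (E - δ)) {x : ℚ}
    (hx : IsFloat p emin x) (hxE : |x| ≤ (2 : ℚ) ^ E) (r : Fin 2) :
    OnGrid ((2 : ℚ) ^ gridExp p α δ E r) (part fl α δ E x r) ∧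
      |part fl α δ E x r| ≤ (2 : ℚ) ^ (p - α) * (2 : ℚ) ^ gridExp p α δ E r := by
  obtain ⟨hg1, hb1, hg2, hb2, -, -, -, -, -⟩ := twoSweep_spec hp hfl hα hδ hE hx hxE
  have h2 : (2 : ℚ) ≠ 0 := by norm_num
  have hpa : ((p - α : ℕ) : ℤ) = (p : ℤ) - α := by omega
  fin_cases r
  · refine ⟨by simpa [part, gridExp] using hg1, ?_⟩
    simp only [part, gridExp, Fin.zero_eta, ↓reduceIte, Nat.cast_zero, mul_zero, sub_zero]
    rw [← zpow_natCast, ← zpow_add₀ h2, hpa]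
    convert hb1 using 2; ring
  · refine ⟨by simpa [part, gridExp] using hg2, ?_⟩
    simp only [part, gridExp, Fin.mk_one, one_ne_zero, ↓reduceIte, Nat.cast_one, mul_one]
    rw [← zpow_natCast, ← zpow_add₀ h2, hpa]
    convert hb2 using 2; ring

/-- THEOREM 1 FOR THE TWO-SWEEP PANELS: panels `P` (`m × n`) and `Q` (`m' × n`) of floating-point
numbers with row exponents `E i`, `F j` (`|P_{ik}| ≤ 2^{E i}`, `|Q_{jk}| ≤ 2^{F j}`), split row-wise by
`twoSweep fl α δ`; if `n·2^{2(p−α)} ≤ 2^p` and the product grid `2^{c+d}` of the parts `r, s` is not below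
`2^{emin}`, then EVERY floating-point evaluation of the slice dot product `Σ_k Pʳ_{ik}Qˢ_{jk}` — any
order, any blocking, with or without fused multiply-add (`dgemm` of `Pʳ (Qˢ)ᵀ`) — is exact.
[cite: OzakiOgitaOishiRump2012, Theorem 1] -/
theorem slice_dot_eval_eq_exact (hp : 1 ≤ p) (hfl : IsRoundNearest p emin fl) {α δ : ℕ}
    (hα : α < p) (hδ : (δ : ℤ) ≤ (p : ℤ) - α) {m m' n : ℕ}
    (P : Matrix (Fin m) (Fin n) ℚ) (Qm : Matrix (Fin m') (Fin n) ℚ) (E : Fin m → ℤ) (F : Fin m' → ℤ)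
    (hP : ∀ i k, IsFloat p emin (P i k)) (hPE : ∀ i k, |P i k| ≤ (2 : ℚ) ^ E i)
    (hQ : ∀ j k, IsFloat p emin (Qm j k)) (hQF : ∀ j k, |Qm j k| ≤ (2 : ℚ) ^ F j)
    (hEe : ∀ i, emin ≤ (α : ℤ) + (E i - δ)) (hFe : ∀ j, emin ≤ (α : ℤ) + (F j - δ))
    (hn : (n : ℚ) * (2 : ℚ) ^ ((p - α) + (p - α)) ≤ (2 : ℚ) ^ p)
    (r s : Fin 2) (i : Fin m) (j : Fin m')
    (he : emin ≤ gridExp p α δ (E i) r + gridExp p α δ (F j) s) (T : DotTree)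
    (hT : T.leaves.Perm (List.ofFn fun k => part fl α δ (E i) (P i k) r * part fl α δ (F j) (Qm j k) s)) :
    T.eval fl = ∑ k, part fl α δ (E i) (P i k) r * part fl α δ (F j) (Qm j k) s :=
  dot_eval_eq_exact hp hfl (c := gridExp p α δ (E i) r) (d := gridExp p α δ (F j) s)
    (s := p - α) (t := p - α) (fun k => part fl α δ (E i) (P i k) r) (fun k => part fl α δ (F j) (Qm j k) s)
    (fun k => (part_spec hp hfl hα hδ (hEe i) (hP i k) (hPE i k) r).1)
    (fun k => (part_spec hp hfl hα hδ (hEe i) (hP i k) (hPE i k) r).2)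
    (fun k => (part_spec hp hfl hα hδ (hFe j) (hQ j k) (hQF j k) s).1)
    (fun k => (part_spec hp hfl hα hδ (hFe j) (hQ j k) (hQF j k) s).2) hn he T hT

/-- THE NUMBERS OF RECORD (binary64 `p = 53`, `emin = −1074`; `α = 32`, `δ = 20`, i.e. `σ₁ = 2^{E+32}`,
`σ₂ = 2^{E+12}`, parts of `21` bits on the grids `2^{E−21}ℤ`, `2^{E−41}ℤ`): for panels of binary64
numbers whose row exponents lie in the window `[−450, 450]` and whose inner dimension is `n ≤ 2048`
(`2048·2^{42} = 2^{53}`), every floating-point evaluation of every slice dot product `Σ_k Pʳ_{ik}Qˢ_{jk}`,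
`r, s ∈ {1, 2}`, in any order / blocking, with or without FMA, is EXACT — no side condition remains.
This is what the hypothesis H-BLAS-EXACT of `cap.ila` is conditioned on (the library must evaluate each
`dgemm` entry as such an evaluation of the `n` products of the stored operands).
[cite: OzakiOgitaOishiRump2012, Theorem 1 (binary64 instance)] -/
theorem binary64_slice_dot_eval_eq_exact (hfl : IsRoundNearest 53 (-1074) fl) {m m' n : ℕ}
    (P : Matrix (Fin m) (Fin n) ℚ) (Qm : Matrix (Fin m') (Fin n) ℚ) (E : Fin m → ℤ) (F : Fin m' → ℤ)
    (hP : ∀ i k, IsFloat 53 (-1074) (P i k)) (hPE : ∀ i k, |P i k| ≤ (2 : ℚ) ^ E i)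
    (hQ : ∀ j k, IsFloat 53 (-1074) (Qm j k)) (hQF : ∀ j k, |Qm j k| ≤ (2 : ℚ) ^ F j)
    (hEw : ∀ i, -450 ≤ E i ∧ E i ≤ 450) (hFw : ∀ j, -450 ≤ F j ∧ F j ≤ 450) (hn : n ≤ 2048)
    (r s : Fin 2) (i : Fin m) (j : Fin m') (T : DotTree)
    (hT : T.leaves.Perm
      (List.ofFn fun k => part fl 32 20 (E i) (P i k) r * part fl 32 20 (F j) (Qm j k) s)) :
    T.eval fl = ∑ k, part fl 32 20 (E i) (P i k) r * part fl 32 20 (F j) (Qm j k) s := by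
  refine slice_dot_eval_eq_exact (p := 53) (emin := -1074) (by norm_num) hfl (by norm_num)
    (by norm_num) P Qm E F hP hPE hQ hQF (fun i => ?_) (fun j => ?_) ?_ r s i j ?_ T hT
  · have := (hEw i).1; push_cast; omega
  · have := (hFw j).1; push_cast; omega
  · have h : (n : ℚ) ≤ 2048 := by exact_mod_cast hn
    calc (n : ℚ) * (2 : ℚ) ^ ((53 - 32) + (53 - 32)) ≤ 2048 * (2 : ℚ) ^ ((53 - 32) + (53 - 32)) :=
          mul_le_mul_of_nonneg_right h (by positivity)
      _ = (2 : ℚ) ^ 53 := by norm_num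
  · have h1 := (hEw i).1; have h2 := (hFw j).1
    have hr : ((r : ℕ) : ℤ) ≤ 1 := by have := r.isLt; omega
    have hs : ((s : ℕ) : ℤ) ≤ 1 := by have := s.isLt; omega
    have hr0 : (0 : ℤ) ≤ (r : ℕ) := by positivity
    have hs0 : (0 : ℤ) ≤ (s : ℕ) := by positivity
    unfold gridExp; push_cast; nlinarith


/-- THEOREM 1 IN DATA FORM, binary64 (the statement the kernels' RUNTIME CHECKS instantiate for every exact
`dgemm`, whatever produced the slices and however many sweeps deep they are): if `xₖ ∈ 2^cℤ` with
`|xₖ| ≤ 2^{21}·2^c`, `yₖ ∈ 2^dℤ` with `|yₖ| ≤ 2^{21}·2^d` (21-bit integer slices on power-of-two row grids —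
re-verified on the arrays by `cap.ila.eftsplit.splitk`), `n ≤ 2048` and `2^{c+d} ≥ 2^{-1074}`, then EVERY
floating-point evaluation of `xᵀy` in binary64 round-to-nearest — any order, any blocking, with or without
fused multiply-add — is EXACT. [cite: OzakiOgitaOishiRump2012, Theorem 1 (binary64, data form)] -/
theorem binary64_dot_eval_eq_exact_of_grid (hfl : IsRoundNearest 53 (-1074) fl) {n : ℕ} {c d : ℤ}
    (x y : Fin n → ℚ) (hx : ∀ k, OnGrid ((2 : ℚ) ^ c) (x k)) (hxb : ∀ k, |x k| ≤ (2 : ℚ) ^ (21 : ℕ) * (2 : ℚ) ^ c)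
    (hy : ∀ k, OnGrid ((2 : ℚ) ^ d) (y k)) (hyb : ∀ k, |y k| ≤ (2 : ℚ) ^ (21 : ℕ) * (2 : ℚ) ^ d)
    (hn : n ≤ 2048) (he : -1074 ≤ c + d) (T : DotTree)
    (hT : T.leaves.Perm (List.ofFn fun k => x k * y k)) :
    T.eval fl = ∑ k, x k * y k := by
  refine dot_eval_eq_exact (p := 53) (emin := -1074) (by norm_num) hfl (s := 21) (t := 21) x y hx hxb hy hyb
    ?_ he T hT
  have h : (n : ℚ) ≤ 2048 := by exact_mod_cast hn
  calc (n : ℚ) * (2 : ℚ) ^ (21 + 21) ≤ 2048 * (2 : ℚ) ^ (21 + 21) :=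
        mul_le_mul_of_nonneg_right h (by positivity)
    _ = (2 : ℚ) ^ 53 := by norm_num

open scoped Matrix in
/-- The same for a whole product of slice matrices `X` (`m × n`, row `i` on the grid `2^{cᵢ}ℤ`) and `Y`
(`m' × n`, row `j` on `2^{dⱼ}ℤ`), as the kernels call `X @ Yᵀ`: every entry of every floating-point
evaluation is the exact `Σ_k X_{ik} Y_{jk}`. [cite: OzakiOgitaOishiRump2012, Theorem 1 (binary64, data form)] -/
theorem binary64_sliceMatrix_eval_eq_exact (hfl : IsRoundNearest 53 (-1074) fl) {m m' n : ℕ}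
    (X : Matrix (Fin m) (Fin n) ℚ) (Y : Matrix (Fin m') (Fin n) ℚ) (c : Fin m → ℤ) (d : Fin m' → ℤ)
    (hX : ∀ i k, OnGrid ((2 : ℚ) ^ c i) (X i k)) (hXb : ∀ i k, |X i k| ≤ (2 : ℚ) ^ (21 : ℕ) * (2 : ℚ) ^ c i)
    (hY : ∀ j k, OnGrid ((2 : ℚ) ^ d j) (Y j k)) (hYb : ∀ j k, |Y j k| ≤ (2 : ℚ) ^ (21 : ℕ) * (2 : ℚ) ^ d j)
    (hn : n ≤ 2048) (he : ∀ i j, -1074 ≤ c i + d j) (i : Fin m) (j : Fin m') (T : DotTree)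
    (hT : T.leaves.Perm (List.ofFn fun k => X i k * Y j k)) :
    T.eval fl = (X * Yᵀ) i j := by
  rw [Matrix.mul_apply]
  simp only [Matrix.transpose_apply]
  exact binary64_dot_eval_eq_exact_of_grid hfl (fun k => X i k) (fun k => Y j k) (fun k => hX i k)
    (fun k => hXb i k) (fun k => hY j k) (fun k => hYb j k) hn (he i j) T hT


/-! ### `k` sweeps (the kernels' `splitk`): parts, remainder, and their specification by induction -/

/-- The remainder after `r` sweeps of the splitting step at the row exponents `E, E − δ, …, E − δ(r−1)`
(`R₀ = x`, `R_{r+1} = fl(R_r − fl(fl(σ_r + R_r) − σ_r))`, `σ_r = 2^α 2^{E − δr}`) — `cap.ila.eftsplit.splitk`.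
[cite: OzakiOgitaOishiRump2012, §2.4 eqs. (14)–(15)] -/
def sweepRem (fl : ℚ → ℚ) (α δ : ℕ) (E : ℤ) : ℕ → ℚ → ℚ
  | 0, x => x
  | r + 1, x => (splitEntry fl α (E - δ * r) (sweepRem fl α δ E r x)).2

/-- The part produced by sweep `r` (0-based): `fl(fl(σ_r + R_r) − σ_r)`.
[cite: OzakiOgitaOishiRump2012, §2.4 eq. (14)] -/
def sweepPart (fl : ℚ → ℚ) (α δ : ℕ) (E : ℤ) (r : ℕ) (x : ℚ) : ℚ :=
  (splitEntry fl α (E - δ * r) (sweepRem fl α δ E r x)).1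

/-- The first two sweeps are `twoSweep`. [cite: OzakiOgitaOishiRump2012, §2.4 eqs. (13)–(15)] -/
theorem twoSweep_eq_sweeps (fl : ℚ → ℚ) (α δ : ℕ) (E : ℤ) (x : ℚ) :
    twoSweep fl α δ E x = (sweepPart fl α δ E 0 x, sweepPart fl α δ E 1 x, sweepRem fl α δ E 2 x) := by
  simp [twoSweep, sweepPart, sweepRem]

/-- SPECIFICATION OF `k` SWEEPS (properties (2)–(5) of Algorithm 1, `k` times; eqs. (14)–(16)): for
`x ∈ F` with `|x| ≤ 2^E`, `α < p`, `δ ≤ p − α` and scales not below `2^{emin}` for the sweeps performed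
(`2^{emin} ≤ σ_r` for `r < k`): every part `r < k` lies on the grid `2^{α+E−δr−p}ℤ` with
`|part r| ≤ 2^{E−δr}`, every part and the remainder are floating-point numbers, the remainder satisfies
`|R_k| ≤ 2^{E−δk}` and, for `k ≥ 1`, the sharper `|R_k| ≤ 2^{α+E−δ(k−1)−p}`, and
`x = Σ_{r<k} part r + R_k` EXACTLY. (binary64, `α = 32`, `δ = 20`: grids `2^{E−21−20r}ℤ`, bounds
`2^{E−20r}`, remainder `2^{E−20k−1}` — the postconditions `cap.ila.eftsplit.splitk` re-verifies.)
[cite: OzakiOgitaOishiRump2012, §2.4 eqs. (14)–(16) with §2.2 (2)–(5)] -/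
theorem sweeps_spec (hp : 1 ≤ p) (hfl : IsRoundNearest p emin fl) {α δ : ℕ} (hα : α < p)
    (hδ : (δ : ℤ) ≤ (p : ℤ) - α) {E : ℤ} {x : ℚ} (hx : IsFloat p emin x) (hxE : |x| ≤ (2 : ℚ) ^ E) :
    ∀ k : ℕ, (∀ r : ℕ, r < k → emin ≤ (α : ℤ) + (E - δ * r)) →
      (∀ r : ℕ, r < k → OnGrid ((2 : ℚ) ^ ((α : ℤ) + (E - δ * r) - p)) (sweepPart fl α δ E r x) ∧
          |sweepPart fl α δ E r x| ≤ (2 : ℚ) ^ (E - δ * r) ∧ IsFloat p emin (sweepPart fl α δ E r x)) ∧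
      IsFloat p emin (sweepRem fl α δ E k x) ∧
      |sweepRem fl α δ E k x| ≤ (2 : ℚ) ^ (E - δ * k) ∧
      (1 ≤ k → |sweepRem fl α δ E k x| ≤ (2 : ℚ) ^ ((α : ℤ) + (E - δ * (k - 1 : ℕ)) - p)) ∧
      x = (∑ r ∈ Finset.range k, sweepPart fl α δ E r x) + sweepRem fl α δ E k x
  | 0, _ => by
      refine ⟨fun r hr => absurd hr (Nat.not_lt_zero r), ?_, ?_, fun h => absurd h (by norm_num), ?_⟩
      · simpa [sweepRem] using hx
      · simpa [sweepRem] using hxE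
      · simp [sweepRem]
  | k + 1, hE => by
      obtain ⟨hparts, hFk, hRk, -, hsum⟩ :=
        sweeps_spec hp hfl hα hδ hx hxE k (fun r hr => hE r (Nat.lt_succ_of_lt hr))
      have hEk : emin ≤ (α : ℤ) + (E - δ * k) := hE k (Nat.lt_succ_self k)
      -- one more splitting step on the remainder `R_k`, at the exponent `E − δk`
      obtain ⟨hg, hb, -, hsum1, habs⟩ := splitEntry_spec hp hfl hα hEk hFk hRk
      have hF := isFloat_splitEntry hfl α (E - δ * k) (sweepRem fl α δ E k x)
      have hrem : sweepRem fl α δ E (k + 1) x = (splitEntry fl α (E - δ * k) (sweepRem fl α δ E k x)).2 := rfl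
      have hpart : sweepPart fl α δ E k x = (splitEntry fl α (E - δ * k) (sweepRem fl α δ E k x)).1 := rfl
      refine ⟨?_, ?_, ?_, ?_, ?_⟩
      · intro r hr
        rcases Nat.lt_succ_iff_lt_or_eq.mp hr with hr' | rfl
        · exact hparts r hr'
        · exact ⟨hpart ▸ hg, hpart ▸ hb, hpart ▸ hF.1⟩
      · exact hrem ▸ hF.2
      · rw [hrem]
        refine habs.trans (zpow_le_zpow_right₀ (by norm_num) ?_)
        push_cast; nlinarith
      · intro _
        rw [hrem]
        simpa using habs
      · rw [Finset.sum_range_succ, hrem, hpart, add_assoc, ← hsum1]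
        exact hsum

/-- THE NUMBERS OF RECORD for `splitk` (binary64 `p = 53`, `emin = −1074`; `α = 32`, `δ = 20`; row
exponent `−400 ≤ E ≤ 450`; up to `k ≤ 8` sweeps): no side condition is left — part `r` lies on
`2^{E−21−20r}ℤ` with `|part r| ≤ 2^{E−20r}`, the remainder after `k ≥ 1` sweeps is at most
`2^{E−20(k−1)−21}`, and the telescoped sum is exact.
[cite: OzakiOgitaOishiRump2012, §2.4 eqs. (14)–(16) (binary64 instance)] -/
theorem binary64_sweeps_spec (hfl : IsRoundNearest 53 (-1074) fl) {E : ℤ} (hEw : -400 ≤ E ∧ E ≤ 450)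
    {x : ℚ} (hx : IsFloat 53 (-1074) x) (hxE : |x| ≤ (2 : ℚ) ^ E) {k : ℕ} (hk : k ≤ 8) :
    (∀ r : ℕ, r < k → OnGrid ((2 : ℚ) ^ (E - 21 - 20 * r)) (sweepPart fl 32 20 E r x) ∧
        |sweepPart fl 32 20 E r x| ≤ (2 : ℚ) ^ (E - 20 * r)) ∧
      (1 ≤ k → |sweepRem fl 32 20 E k x| ≤ (2 : ℚ) ^ (E - 20 * (k - 1 : ℕ) - 21)) ∧
      x = (∑ r ∈ Finset.range k, sweepPart fl 32 20 E r x) + sweepRem fl 32 20 E k x := by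
  have hE : ∀ r : ℕ, r < k → (-1074 : ℤ) ≤ ((32 : ℕ) : ℤ) + (E - ((20 : ℕ) : ℤ) * r) := by
    intro r hr
    have : (r : ℤ) ≤ 7 := by omega
    push_cast; omega
  obtain ⟨hparts, -, -, hsharp, hsum⟩ :=
    sweeps_spec (p := 53) (emin := -1074) (by norm_num) hfl (α := 32) (δ := 20) (by norm_num)
      (by norm_num) hx hxE k hE
  refine ⟨fun r hr => ?_, fun h1 => ?_, hsum⟩
  · obtain ⟨hg, hb, -⟩ := hparts r hr
    refine ⟨?_, by simpa using hb⟩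
    have : ((32 : ℕ) : ℤ) + (E - ((20 : ℕ) : ℤ) * r) - (53 : ℕ) = E - 21 - 20 * r := by push_cast; ring
    rw [this] at hg; exact hg
  · have h := hsharp h1
    have : ((32 : ℕ) : ℤ) + (E - ((20 : ℕ) : ℤ) * ((k - 1 : ℕ) : ℤ)) - (53 : ℕ) = E - 20 * ((k - 1 : ℕ) : ℤ) - 21 := by
      push_cast; ring
    rw [this] at h; exact h


/-! ### No overflow in the window: every sub-evaluation is exact and bounded (certnum-ref-2's nit, 2026-08-27) -/

/-- A sub-multiset of terms on a grid below capacity still evaluates exactly, and its value is bounded by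
the full absolute sum: for `xₖ ∈ 2^cℤ`, `|xₖ| ≤ 2^{21}2^c`, `yₖ ∈ 2^dℤ`, `|yₖ| ≤ 2^{21}2^d`, `n ≤ 2048`,
`2^{c+d} ≥ 2^{-1074}`, EVERY evaluation tree `S` whose leaves are SOME of the products `xₖyₖ` (a
sub-permutation — every intermediate node of a `dgemm` entry's evaluation is such a tree) satisfies
`S.eval fl = S.exact` and `|S.eval fl| ≤ 2^{53}·2^{c+d}` (binary64, any round-to-nearest `fl`).
[cite: OzakiOgitaOishiRump2012, Theorem 1 (proof, eqs. (18)–(24)) (binary64, every partial evaluation)] -/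
theorem binary64_partial_eval_exact_and_abs_le (hfl : IsRoundNearest 53 (-1074) fl) {n : ℕ} {c d : ℤ}
    (x y : Fin n → ℚ) (hx : ∀ k, OnGrid ((2 : ℚ) ^ c) (x k)) (hxb : ∀ k, |x k| ≤ (2 : ℚ) ^ (21 : ℕ) * (2 : ℚ) ^ c)
    (hy : ∀ k, OnGrid ((2 : ℚ) ^ d) (y k)) (hyb : ∀ k, |y k| ≤ (2 : ℚ) ^ (21 : ℕ) * (2 : ℚ) ^ d)
    (hn : n ≤ 2048) (he : -1074 ≤ c + d) (S : DotTree)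
    (hS : S.leaves.Subperm (List.ofFn fun k => x k * y k)) :
    S.eval fl = S.exact ∧ |S.eval fl| ≤ (2 : ℚ) ^ (53 : ℕ) * (2 : ℚ) ^ (c + d) := by
  -- the full absolute sum is below capacity
  have hfull : ((List.ofFn fun k => x k * y k).map abs).sum ≤ (2 : ℚ) ^ (53 : ℕ) * (2 : ℚ) ^ (c + d) := by
    rw [List.map_ofFn, List.sum_ofFn]
    have hnq : (n : ℚ) ≤ 2048 := by exact_mod_cast hn
    calc ∑ k, (abs ∘ fun k => x k * y k) k = ∑ k, |x k * y k| := rfl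
      _ ≤ ∑ _k : Fin n, (2 : ℚ) ^ (21 + 21) * (2 : ℚ) ^ (c + d) :=
          Finset.sum_le_sum fun k _ => abs_mul_le_of_parts (hxb k) (hyb k)
      _ = (n : ℚ) * ((2 : ℚ) ^ (21 + 21) * (2 : ℚ) ^ (c + d)) := by
          rw [Finset.sum_const, Finset.card_univ, Fintype.card_fin, nsmul_eq_mul]
      _ ≤ 2048 * ((2 : ℚ) ^ (21 + 21) * (2 : ℚ) ^ (c + d)) :=
          mul_le_mul_of_nonneg_right hnq (by positivity)
      _ = (2 : ℚ) ^ (53 : ℕ) * (2 : ℚ) ^ (c + d) := by ring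
  -- the sub-permutation's absolute sum is at most the full one
  have hsub : S.absSum ≤ (2 : ℚ) ^ (53 : ℕ) * (2 : ℚ) ^ (c + d) := by
    obtain ⟨l, hperm, hsubl⟩ := hS
    have h1 : (S.leaves.map abs).sum = (l.map abs).sum := (hperm.map abs).sum_eq.symm
    have h2 : (l.map abs).sum ≤ ((List.ofFn fun k => x k * y k).map abs).sum :=
      List.Sublist.sum_le_sum (hsubl.map abs) fun a ha => by
        obtain ⟨b, -, rfl⟩ := List.mem_map.mp ha
        exact abs_nonneg b
    unfold DotTree.absSum
    linarith
  -- every leaf is a product on the grid 2^(c+d)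
  have hgrid : ∀ z ∈ S.leaves, OnGrid ((2 : ℚ) ^ (c + d)) z := by
    intro z hz
    have hz' : z ∈ List.ofFn fun k => x k * y k := hS.subset hz
    rw [List.mem_ofFn] at hz'
    obtain ⟨k, rfl⟩ := hz'
    exact onGrid_mul (hx k) (hy k)
  have hex : S.eval fl = S.exact :=
    dotTree_eval_eq_exact (p := 53) (emin := -1074) (by norm_num) hfl he S hgrid (by simpa using hsub)
  refine ⟨hex, ?_⟩
  rw [hex]
  exact (DotTree.abs_exact_le_absSum S).trans hsub

/-- … hence INSIDE THE KERNELS' WINDOW (`c + d ≤ 858`, from row exponents `≤ 450`) every intermediate of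
every evaluation has modulus `≤ 2^911` — below binary64's overflow threshold `2^1024`: the window makes the
model statements of this file statements about real binary64.
[cite: OzakiOgitaOishiRump2012, Theorem 1 (binary64; no overflow in the window)] -/
theorem binary64_partial_eval_abs_le_two_pow_911 (hfl : IsRoundNearest 53 (-1074) fl) {n : ℕ} {c d : ℤ}
    (x y : Fin n → ℚ) (hx : ∀ k, OnGrid ((2 : ℚ) ^ c) (x k)) (hxb : ∀ k, |x k| ≤ (2 : ℚ) ^ (21 : ℕ) * (2 : ℚ) ^ c)
    (hy : ∀ k, OnGrid ((2 : ℚ) ^ d) (y k)) (hyb : ∀ k, |y k| ≤ (2 : ℚ) ^ (21 : ℕ) * (2 : ℚ) ^ d)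
    (hn : n ≤ 2048) (he : -1074 ≤ c + d) (hcd : c + d ≤ 858) (S : DotTree)
    (hS : S.leaves.Subperm (List.ofFn fun k => x k * y k)) :
    |S.eval fl| ≤ (2 : ℚ) ^ (911 : ℤ) := by
  have h := (binary64_partial_eval_exact_and_abs_le hfl x y hx hxb hy hyb hn he S hS).2
  refine h.trans ?_
  rw [← zpow_natCast, ← zpow_add₀ (by norm_num : (2 : ℚ) ≠ 0)]
  exact zpow_le_zpow_right₀ (by norm_num) (by push_cast; omega)

end Literature.ComputerArithmetic.OzakiOgitaOishiRump2012
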